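import Summits.Ventures.PercRepro.SingleMerge

/-!
# The pair-sum inequality for three marked vertices

For Bernoulli bond percolation on a finite multigraph with edge probabilities `p ∈ [0, 1]^E` and
three marked vertices `a, b, c`, with the partition law `(x, y₁, y₂, y₃, z)` of
`Summits.Ventures.PercRepro.SingleMerge`,

**Pair-sum inequality** (`pair_sum`): `x · z ≥ y₁ y₂ + y₁ y₃ + y₂ y₃`.

It is the instance `A_{TB} = A_{BT} = 1/2`, `A_{P_i P_j} = -1/2` (`i ≠ j`), all other entries `0`,
of single-merge concavity (`quad_nonneg_of_moves`): the diagonal of `A` vanishes and the bilinear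
form of `A` is `≤ 0` on all `49` pairs of move vectors (`pairSumMatrix_moves`).
-/

namespace PercRepro

namespace MultiGraph

variable {E : Type*} [Fintype E] [DecidableEq E] {V : Type*} (G : MultiGraph V E)

/-- The matrix of the pair-sum form `x z - (y₁ y₂ + y₁ y₃ + y₂ y₃)`:
`A_{TB} = A_{BT} = 1/2`, `A_{P_i P_j} = -1/2` for `i ≠ j`, all other entries `0`. -/
noncomputable def pairSumMatrix : Fin 5 → Fin 5 → ℝ :=
  ![![0, 0, 0, 0, 1 / 2],
    ![0, 0, -1 / 2, -1 / 2, 0],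
    ![0, -1 / 2, 0, -1 / 2, 0],
    ![0, -1 / 2, -1 / 2, 0, 0],
    ![1 / 2, 0, 0, 0, 0]]

/-- The pair-sum form evaluates to `x z - (y₁ y₂ + y₁ y₃ + y₂ y₃)`. -/
theorem bilin_pairSumMatrix (π : Fin 5 → ℝ) :
    bilin pairSumMatrix π π = π 0 * π 4 - (π 1 * π 2 + π 1 * π 3 + π 2 * π 3) := by
  simp only [bilin, Fin.sum_univ_five, pairSumMatrix]
  simp [Matrix.cons_val]
  ring

/-- The diagonal of the pair-sum matrix vanishes. -/
theorem pairSumMatrix_diag_nonneg (i : Fin 5) : 0 ≤ pairSumMatrix i i := by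
  fin_cases i <;> simp [pairSumMatrix]

/-- The pair-sum form is `≤ 0` on every pair of move vectors (`49` cases). -/
theorem pairSumMatrix_moves (mv mv' : Move) : bilin pairSumMatrix mv.vec mv'.vec ≤ 0 := by
  cases mv <;> cases mv' <;>
    simp [bilin, Fin.sum_univ_five, pairSumMatrix, Move.vec, Move.ivec] <;> norm_num

/-- **The pair-sum inequality.**  For Bernoulli bond percolation on a finite multigraph with
edge probabilities `p ∈ [0, 1]^E` and any three vertices `a, b, c`,
`P(a~b ∧ b~c) · P(a≁b ∧ b≁c ∧ a≁c) ≥ P(a~b ∧ b≁c) · P(a~c ∧ a≁b) + P(a~b ∧ b≁c) · P(b~c ∧ a≁b)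
+ P(a~c ∧ a≁b) · P(b~c ∧ a≁b)`, i.e. `x z ≥ y₁ y₂ + y₁ y₃ + y₂ y₃` for the partition law
`(x, y₁, y₂, y₃, z)` of the three marked vertices. -/
theorem pair_sum (p : E → ℝ) (hp : IsProb p) (a b c : V) :
    prob p (G.connEvent a b ∩ G.sepEvent b c) * prob p (G.connEvent a c ∩ G.sepEvent a b) +
      prob p (G.connEvent a b ∩ G.sepEvent b c) * prob p (G.connEvent b c ∩ G.sepEvent a b) +
      prob p (G.connEvent a c ∩ G.sepEvent a b) * prob p (G.connEvent b c ∩ G.sepEvent a b) ≤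
    prob p (G.connEvent a b ∩ G.connEvent b c) *
      prob p (G.sepEvent a b ∩ G.sepEvent b c ∩ G.sepEvent a c) := by
  have h := G.quad_nonneg_of_moves pairSumMatrix pairSumMatrix_diag_nonneg pairSumMatrix_moves
    p hp a b c
  rw [bilin_pairSumMatrix] at h
  simp [triLaw, triEvent] at h
  linarith

end MultiGraph

end PercRepro
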